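import Literature.NumberTheory.EllipticCurves.BhargavaShankarLatticeCount
import Literature.MeasureTheory.Group.SL2CoordSetIntegral
import HarnessLib

/-!
# Bhargava–Shankar, Theorem 2.1: the averaging integral over the fundamental domain

The component "C" of the proof of [BhargavaShankarAnnals2015, Thm 2.1] (§2.3 of the paper): the
averaging integral
`Λ_irr(X) = ∫_𝓕 #{x ∈ V_ℤ irreducible : x ∈ g G₀ R·L} dμ(g)`
over Gauss's fundamental domain `𝓕` for `GL₂(ℤ)` in `SL₂^±(ℝ)` is evaluated up to
`O(X^{3/4+ε})`-type errors:

* pointwise in `g = n(x) a(√y) k(θ) ∈ 𝓕` (`body_pointwise`): in the *main body*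
  `C₁ X^{1/6} y⁻² ≥ 1` the number of irreducible lattice points in the region `S_g` is
  `X^{5/6} vol(B₁) + O(Λ⁴ y²) − O((C₁X^{1/6})⁴ y²) − (reducible forms with e ≠ 0)`, combining the
  Lipschitz lattice-point count (`BhargavaShankarLatticeCount`), the slice `e = 0`
  (`ncard_e_zero_le`) and irreducibility; in the *cusp* `C₁ X^{1/6} y⁻² < 1` every lattice point
  of `S_g` has `e = 0`, hence is reducible, and the count vanishes (`countFn_irr_eq_zero_of_cusp`);
* the cusp height `Y₀ = (C₁ X^{1/6})^{1/2}` and the decomposition `𝓕 = bodyFD ⊔ cuspFD`, with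
  `bodyFD ⊆ coordSet (rectBetween (√3/2) Y₀) (arc 0 π)`, `cuspFD ⊆ coordSet (stripAbove Y₀) (arc 0 π)`,
  `μ(cuspFD) ≤ π / Y₀` and `∫_{bodyFD} E y² dμ ≤ E (Y₀ − √3/2) π` (`SL2CoordSetIntegral`);
* the two-sided bounds (`LamIrr_le`, `LamIrr_ge`, `LamIrr_toReal_bounds`):
  `Λ_irr ≤ M μ(𝓕) + E₁ (Y₀ − √3/2) π` and
  `M μ(𝓕) ≤ Λ_irr + (E₁ + E₂)(Y₀ − √3/2) π + Red μ(𝓕) + M π / Y₀`,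
  `M = X^{5/6} vol(B₁)`, `E₁ = 576000 K Λ⁴`, `E₂ = 256 (C₁ X^{1/6})⁴`, for every uniform bound `Red`
  of the reducible forms with `e ≠ 0` counted in the main body (supplied by Lemma 2.3 in the
  assembly).

Everything is proved; there are no new definitions of mathematical content beyond the explicit
sets `bodyFD`, `cuspFD`, the height `Y0` and the integral `LamIrr`.

## References

* M. Bhargava, A. Shankar, *Binary quartic forms having bounded invariants, and the boundedness
  of the average rank of elliptic curves*, Ann. of Math. (2) 181 (2015) 191–242, §2.3
  (displays (5)–(17): the averaging integral, the cut-off of the cusp and the estimate of the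
  main body); arXiv:1006.1002v2 numbering. [cite: BhargavaShankarAnnals2015, §2.3 (displays (5)–(17); arXiv:1006.1002v2 numbering)]
-/

noncomputable section

open Real MeasureTheory Matrix Set Filter Topology
open scoped MatrixGroups Pointwise ENNReal UpperHalfPlane

namespace Literature.NumberTheory.EllipticCurves

namespace BinaryQuartic

open Literature.MeasureTheory.Group Literature.Algebra.EuclideanLattices

attribute [local instance] Literature.MeasureTheory.Group.fact_two_pi_pos

variable {K : ℕ} (D : Fin K → Piece)

/-! ## Coordinates of the points of Gauss's fundamental domain -/

/-- **A point of `gaussFD` in coordinates**: `g = ñ(x) a(√y) k(θ)` with `x = x(g)`, `y = y(g)`,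
`|x| ≤ ½`, `y ≥ √3/2`. [folklore] -/
theorem coords_of_mem_gaussFD {g : Matrix (Fin 2) (Fin 2) ℝ} (hg : g ∈ gaussFD) :
    ∃ θ : ℝ, |xOf g| ≤ 1 / 2 ∧ Real.sqrt 3 / 2 ≤ yOf g ∧ 0 < yOf g ∧ g = iwasawaGinv (xOf g) (yOf g) θ := by
  obtain ⟨hdet, hfd, hθ⟩ := hg
  obtain ⟨h1, h2⟩ := hfd
  set G : SL(2, ℝ) := ⟨g, hdet⟩ with hG
  have hcoe := coe_smul_I_eq G
  have hy : 0 < yOf g := by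
    have := (G • UpperHalfPlane.I).im_pos
    rw [← UpperHalfPlane.coe_im, hcoe] at this
    exact this
  have hy2 : Real.sqrt 3 / 2 ≤ yOf g := by
    rw [Complex.normSq_mk] at h1
    have hx : (xOf g) ^ 2 ≤ 1 / 4 := by
      have := abs_le.1 h2; nlinarith
    have h34 : 3 / 4 ≤ (yOf g) ^ 2 := by nlinarith
    have hs : Real.sqrt 3 / 2 = Real.sqrt (3 / 4) := by
      rw [Real.sqrt_div (by norm_num), show (4:ℝ) = 2 ^ 2 by norm_num, Real.sqrt_sq (by norm_num)]
    rw [hs, ← Real.sqrt_sq hy.le]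
    exact Real.sqrt_le_sqrt h34
  obtain ⟨θ, hθ'⟩ := QuotientAddGroup.mk_surjective (angleOf g)
  refine ⟨θ, h2, hy2, hy, ?_⟩
  have hdec := eq_iwasawa G
  have hz : (G • UpperHalfPlane.I : ℍ) = ⟨⟨xOf g, yOf g⟩, hy⟩ := UpperHalfPlane.ext (by rw [hcoe])
  change g = iwasawa _ at hdec
  rw [hz, show angleOf (G : Matrix (Fin 2) (Fin 2) ℝ) = angleOf g from rfl, ← hθ'] at hdec
  exact hdec.trans (iwasawa_eq_iwasawaGinv _ hy θ)

/-- `y(g)` is measurable. [folklore] -/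
theorem measurable_yOf [MeasurableSpace (Matrix (Fin 2) (Fin 2) ℝ)] [BorelSpace (Matrix (Fin 2) (Fin 2) ℝ)] :
    Measurable (yOf : Matrix (Fin 2) (Fin 2) ℝ → ℝ) := by
  have : (yOf : Matrix (Fin 2) (Fin 2) ℝ → ℝ) = Complex.im ∘ fun g => (⟨xOf g, yOf g⟩ : ℂ) := by
    funext g; rfl
  rw [this]
  exact Complex.measurable_im.comp measurable_coordC

/-! ## The counting function as a cardinality -/

/-- **The counting function of irreducible forms at `g ∈ SL₂(ℝ)`**:
`N(g) = #{x ∈ V_ℤ irreducible : coeffs(x_ℝ) ∈ S_g}`. [folklore] -/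
theorem countFn_irr_eq_encard (𝓛 : Set (BinaryQuartic ℝ)) {g : Matrix (Fin 2) (Fin 2) ℝ} (hg : g.det = 1) :
    countFn 𝓛 {x | x.IsIrreducible} g =
      ({x : BinaryQuartic ℤ | x.IsIrreducible ∧ (x.map (Int.castRingHom ℝ)).coeffs ∈ regionS 𝓛 g}).encard := by
  have e : {x ∈ {x : BinaryQuartic ℤ | x.IsIrreducible} | g ∈ Eset 𝓛 x} =
      {x : BinaryQuartic ℤ | x.IsIrreducible ∧ (x.map (Int.castRingHom ℝ)).coeffs ∈ regionS 𝓛 g} := by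
    ext x
    simp only [Set.mem_setOf_eq, mem_Eset_iff_coeffs_mem hg]
  -- `∑_{x ∈ 𝒮} 1_{E(x)}(g) = #{x ∈ 𝒮 : g ∈ E(x)}` (also available as `countFn_eq_encard` in
  -- `BhargavaShankarCongruenceCountFnProofs.lean`; inlined to keep the import graph small)
  have hce : ∀ 𝒮 : Set (BinaryQuartic ℤ), countFn 𝓛 𝒮 g = ({x ∈ 𝒮 | g ∈ Eset 𝓛 x}).encard := by
    intro 𝒮
    unfold countFn
    rw [← ENNReal.tsum_set_one, tsum_subtype 𝒮 (fun x => (Eset 𝓛 x).indicator 1 g),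
      tsum_subtype {x ∈ 𝒮 | g ∈ Eset 𝓛 x} (fun _ => (1 : ℝ≥0∞))]
    refine tsum_congr fun x => ?_
    simp only [Set.indicator, Set.mem_sep_iff, Pi.one_apply]
    by_cases hx : x ∈ 𝒮 <;> by_cases hg : g ∈ Eset 𝓛 x <;> simp [hx, hg]
  rw [hce, e]

/-- Lattice points of `S_g` and integral forms counted at `g` correspond under `coeffs`.
[folklore] -/
theorem ncard_forms_eq_ncard_intPt (𝓛 : Set (BinaryQuartic ℝ)) (g : Matrix (Fin 2) (Fin 2) ℝ) :
    ({x : BinaryQuartic ℤ | (x.map (Int.castRingHom ℝ)).coeffs ∈ regionS 𝓛 g}).ncard =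
      ({z : Fin 5 → ℤ | intPt z ∈ regionS 𝓛 g}).ncard := by
  have e : {z : Fin 5 → ℤ | intPt z ∈ regionS 𝓛 g} =
      (fun x : BinaryQuartic ℤ => x.coeffs) '' {x : BinaryQuartic ℤ | (x.map (Int.castRingHom ℝ)).coeffs ∈ regionS 𝓛 g} := by
    ext z
    constructor
    · intro hz
      refine ⟨ofCoeffs z, ?_, coeffs_ofCoeffs z⟩
      simp only [Set.mem_setOf_eq, coeffs_map_intCast, coeffs_ofCoeffs]
      exact hz
    · rintro ⟨x, hx, rfl⟩
      simp only [Set.mem_setOf_eq, coeffs_map_intCast] at hx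
      exact hx
  rw [e, Set.ncard_image_of_injective _ coeffs_injective]

/-! ## The cusp and the main body, pointwise -/

/-- **Cusp**: if `C₁ X^{1/6} y(g)⁻² < 1` then no irreducible form is counted at `g ∈ 𝓕`.
[cite: BhargavaShankarAnnals2015, §2.3 (cutting off the cusp: all points have a = 0; arXiv:1006.1002v2 numbering)] -/
theorem countFn_irr_eq_zero_of_cusp {X : ℝ} (hX : 0 < X) {g : Matrix (Fin 2) (Fin 2) ℝ} (hg : g ∈ gaussFD)
    (hcusp : C₁ * X ^ (1 / 6 : ℝ) * ((yOf g)⁻¹) ^ 2 < 1) :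
    countFn (sections D X) {x | x.IsIrreducible} g = 0 := by
  obtain ⟨θ, hx, hy, hy0, hgeq⟩ := coords_of_mem_gaussFD hg
  have hempty : {x : BinaryQuartic ℤ | x.IsIrreducible ∧ (x.map (Int.castRingHom ℝ)).coeffs ∈ regionS (sections D X) g} = ∅ := by
    ext x
    simp only [Set.mem_setOf_eq, Set.mem_empty_iff_false, iff_false, not_and]
    intro hirr hmem
    rw [hgeq] at hmem
    have he := e_eq_zero_of_cusp (Real.rpow_nonneg hX.le _) (fun ℓ hℓ l => sections_coeff_le D hX.le hℓ l) hx hy hcusp hmem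
    exact not_isIrreducible_of_e_eq_zero he hirr
  rw [countFn_irr_eq_encard _ hg.1, hempty, Set.encard_empty]
  simp

/-- `x(ñ(x) a(√y) k(θ)) = x`, `y(ñ(x) a(√y) k(θ)) = y`. [folklore] -/
theorem xOf_yOf_iwasawaGinv (x : ℝ) {y : ℝ} (hy : 0 < y) (θ : ℝ) :
    xOf (iwasawaGinv x y θ) = x ∧ yOf (iwasawaGinv x y θ) = y := by
  rw [← iwasawa_eq_iwasawaGinv x hy θ, xOf_iwasawa, yOf_iwasawa]
  exact ⟨rfl, rfl⟩

/-- The set of forms counted at `g = ñ(x) a(√y) k(θ)` is finite. [folklore] -/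
theorem finite_counted {X : ℝ} (hX : 0 < X) {x y θ : ℝ} (hx : |x| ≤ 1 / 2) (hy : Real.sqrt 3 / 2 ≤ y) :
    ({f : BinaryQuartic ℤ | (f.map (Int.castRingHom ℝ)).coeffs ∈ regionS (sections D X) (iwasawaGinv x y θ)}).Finite := by
  have hR := Real.rpow_nonneg hX.le (1 / 6 : ℝ)
  refine (finite_and_ncard_le_of_injOn_pi (fun f : BinaryQuartic ℤ => f.coeffs) coeffs_injective.injOn
    ![⌊C₁ * X ^ (1 / 6 : ℝ) * y ^ 2⌋₊, ⌊C₁ * X ^ (1 / 6 : ℝ) * y⌋₊, ⌊C₁ * X ^ (1 / 6 : ℝ)⌋₊,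
      ⌊C₁ * X ^ (1 / 6 : ℝ) * y⁻¹⌋₊, ⌊C₁ * X ^ (1 / 6 : ℝ) * (y⁻¹) ^ 2⌋₊] ?_).1
  intro f hf i
  obtain ⟨b0, b1, b2, b3, b4⟩ := regionS_coeff_bounds hR (fun ℓ hℓ l => sections_coeff_le D hX.le hℓ l) hx hy hf
  simp only [coeffs_map_intCast] at b0 b1 b2 b3 b4
  fin_cases i
  · exact abs_le_floor_of_abs_cast_le b0
  · exact abs_le_floor_of_abs_cast_le b1
  · exact abs_le_floor_of_abs_cast_le b2
  · exact abs_le_floor_of_abs_cast_le b3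
  · exact abs_le_floor_of_abs_cast_le b4

/-- **Main body, pointwise**: at `g = ñ(x) a(√y) k(θ)` with `|x| ≤ ½`, `y ≥ √3/2`,
`C₁ X^{1/6} y⁻² ≥ 1`, the number `N(g)` of irreducible forms counted at `g` is finite and, with
`M = X^{5/6} vol(B₁)`, `M − 576000KΛ⁴y² − 256(C₁X^{1/6})⁴y² − Red ≤ N(g) ≤ M + 576000KΛ⁴y²`,
where `Red` is any bound for the reducible forms with `e ≠ 0` counted at `g` (Lemma 2.3).
[cite: BhargavaShankarAnnals2015, §2.3 (displays (13)–(15); arXiv:1006.1002v2 numbering)] -/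
theorem body_pointwise {X : ℝ} (hX : 1 ≤ X) {x y θ : ℝ} (hx : |x| ≤ 1 / 2) (hy : Real.sqrt 3 / 2 ≤ y)
    (hbody : 1 ≤ C₁ * X ^ (1 / 6 : ℝ) * (y⁻¹) ^ 2) {Red : ℝ}
    (hRed : (({f : BinaryQuartic ℤ | (f.map (Int.castRingHom ℝ)).coeffs ∈ regionS (sections D X) (iwasawaGinv x y θ) ∧
        f.e ≠ 0 ∧ ¬ f.IsIrreducible}).ncard : ℝ) ≤ Red) :
    ({f : BinaryQuartic ℤ | f.IsIrreducible ∧ (f.map (Int.castRingHom ℝ)).coeffs ∈ regionS (sections D X) (iwasawaGinv x y θ)}).Finite ∧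
    (({f : BinaryQuartic ℤ | f.IsIrreducible ∧
        (f.map (Int.castRingHom ℝ)).coeffs ∈ regionS (sections D X) (iwasawaGinv x y θ)}).ncard : ℝ) ≤
        X ^ (5 / 6 : ℝ) * volume.real (B1set D) + 576000 * K * Lam D X ^ 4 * y ^ 2 ∧
    X ^ (5 / 6 : ℝ) * volume.real (B1set D) - 576000 * K * Lam D X ^ 4 * y ^ 2 -
        256 * (C₁ * X ^ (1 / 6 : ℝ)) ^ 4 * y ^ 2 - Red ≤
      (({f : BinaryQuartic ℤ | f.IsIrreducible ∧
        (f.map (Int.castRingHom ℝ)).coeffs ∈ regionS (sections D X) (iwasawaGinv x y θ)}).ncard : ℝ) := by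
  have hX0 : 0 < X := by linarith
  have hy0 : 0 < y := lt_of_lt_of_le (by positivity) hy
  have hR := Real.rpow_nonneg hX0.le (1 / 6 : ℝ)
  have hcoefL : ∀ ℓ ∈ sections D X, ∀ l, |ℓ.coeffs l| ≤ X ^ (1 / 6 : ℝ) := fun ℓ hℓ l => sections_coeff_le D hX0.le hℓ l
  set S := regionS (sections D X) (iwasawaGinv x y θ) with hS
  set All := {f : BinaryQuartic ℤ | (f.map (Int.castRingHom ℝ)).coeffs ∈ S}
  set Irr := {f : BinaryQuartic ℤ | f.IsIrreducible ∧ (f.map (Int.castRingHom ℝ)).coeffs ∈ S}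
  set E0 := {f : BinaryQuartic ℤ | (f.map (Int.castRingHom ℝ)).coeffs ∈ S ∧ f.e = 0}
  set Rd := {f : BinaryQuartic ℤ | (f.map (Int.castRingHom ℝ)).coeffs ∈ S ∧ f.e ≠ 0 ∧ ¬ f.IsIrreducible}
  have hfinAll : All.Finite := finite_counted D hX0 hx hy
  have hIrrsub : Irr ⊆ All := fun f hf => hf.2
  have hfinIrr : Irr.Finite := hfinAll.subset hIrrsub
  have hcover : All ⊆ Irr ∪ (E0 ∪ Rd) := by
    intro f hf
    by_cases hirr : f.IsIrreducible
    · exact Or.inl ⟨hirr, hf⟩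
    · by_cases he : f.e = 0
      · exact Or.inr (Or.inl ⟨hf, he⟩)
      · exact Or.inr (Or.inr ⟨hf, he, hirr⟩)
  -- lattice count
  have hCΛ : C₁ * X ^ (1 / 6 : ℝ) ≤ Lam D X := by
    -- `Λ = 20 C₁ L X^{1/6} ≥ C₁ X^{1/6}` (`L ≥ 1`)
    unfold Lam
    have h1 := one_le_Lmax D
    have hC := C₁_pos
    have hX6 := Real.rpow_nonneg hX0.le (1 / 6 : ℝ)
    nlinarith [mul_nonneg hC.le hX6, mul_nonneg (mul_nonneg hC.le hX6) (by linarith : (0:ℝ) ≤ Lmax D - 1)]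
  have hbody' : 1 ≤ Lam D X * (y⁻¹) ^ 2 :=
    hbody.trans (mul_le_mul_of_nonneg_right hCΛ (by positivity))
  have hlat := abs_latticeCount_sub_le D hX hx hy hbody' (θ := θ)
  rw [← ncard_forms_eq_ncard_intPt] at hlat
  have hlat1 := (abs_le.1 hlat).1
  have hlat2 := (abs_le.1 hlat).2
  -- the reducible families
  obtain ⟨hfinE0, hE0⟩ := ncard_e_zero_le hR hcoefL hx hy hbody (θ := θ)
  refine ⟨hfinIrr, ?_, ?_⟩
  · have h1 : Irr.ncard ≤ All.ncard := Set.ncard_le_ncard hIrrsub hfinAll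
    have h1' : (Irr.ncard : ℝ) ≤ All.ncard := by exact_mod_cast h1
    linarith
  · have hfinRd : Rd.Finite := hfinAll.subset fun f hf => hf.1
    have h2 : All.ncard ≤ Irr.ncard + (E0.ncard + Rd.ncard) := by
      calc All.ncard ≤ (Irr ∪ (E0 ∪ Rd)).ncard := Set.ncard_le_ncard hcover (hfinIrr.union (hfinE0.union hfinRd))
        _ ≤ Irr.ncard + (E0 ∪ Rd).ncard := Set.ncard_union_le _ _
        _ ≤ Irr.ncard + (E0.ncard + Rd.ncard) := Nat.add_le_add_left (Set.ncard_union_le _ _) _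
    have h2' : (All.ncard : ℝ) ≤ Irr.ncard + (E0.ncard + Rd.ncard) := by exact_mod_cast h2
    linarith

/-! ## The cusp height `Y₀`, the body and the cusp of the fundamental domain -/

/-- The cusp height `Y₀ = (C₁ X^{1/6})^{1/2}`: `y > Y₀ ↔ C₁ X^{1/6} y⁻² < 1`. [folklore] -/
def Y0 (X : ℝ) : ℝ := Real.sqrt (C₁ * X ^ (1 / 6 : ℝ))

/-- `Y0_pos` (auxiliary). [folklore] -/
theorem Y0_pos {X : ℝ} (hX : 0 < X) : 0 < Y0 X :=
  Real.sqrt_pos.2 (mul_pos C₁_pos (Real.rpow_pos_of_pos hX _))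

/-- `Y0_sq` (auxiliary). [folklore] -/
theorem Y0_sq {X : ℝ} (hX : 0 ≤ X) : Y0 X ^ 2 = C₁ * X ^ (1 / 6 : ℝ) :=
  Real.sq_sqrt (mul_nonneg C₁_pos.le (Real.rpow_nonneg hX _))

/-- `cusp_iff_lt` (auxiliary). [folklore] -/
theorem cusp_iff_lt {X : ℝ} (hX : 0 < X) {y : ℝ} (hy : 0 < y) :
    C₁ * X ^ (1 / 6 : ℝ) * (y⁻¹) ^ 2 < 1 ↔ Y0 X < y := by
  have hY := Y0_pos hX
  rw [← Y0_sq hX.le]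
  have e : Y0 X ^ 2 * (y⁻¹) ^ 2 = (Y0 X / y) ^ 2 := by rw [div_eq_mul_inv, mul_pow]
  rw [e, sq_lt_one_iff_abs_lt_one, abs_of_pos (div_pos hY hy), div_lt_one hy]

/-- The main body of the fundamental domain: `y(g) ≤ Y₀`. [folklore] -/
def bodyFD (X : ℝ) : Set (Matrix (Fin 2) (Fin 2) ℝ) := gaussFD ∩ {g | 1 ≤ C₁ * X ^ (1 / 6 : ℝ) * ((yOf g)⁻¹) ^ 2}

/-- The cusp of the fundamental domain: `y(g) > Y₀`. [folklore] -/
def cuspFD (X : ℝ) : Set (Matrix (Fin 2) (Fin 2) ℝ) := gaussFD ∩ {g | C₁ * X ^ (1 / 6 : ℝ) * ((yOf g)⁻¹) ^ 2 < 1}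

/-- `bodyFD_union_cuspFD` (auxiliary). [folklore] -/
theorem bodyFD_union_cuspFD (X : ℝ) : bodyFD X ∪ cuspFD X = gaussFD := by
  ext g
  simp only [bodyFD, cuspFD, Set.mem_union, Set.mem_inter_iff, Set.mem_setOf_eq]
  constructor
  · rintro (⟨h, -⟩ | ⟨h, -⟩) <;> exact h
  · intro h; by_cases hb : 1 ≤ C₁ * X ^ (1 / 6 : ℝ) * ((yOf g)⁻¹) ^ 2
    · exact Or.inl ⟨h, hb⟩
    · exact Or.inr ⟨h, not_le.1 hb⟩

/-- `disjoint_bodyFD_cuspFD` (auxiliary). [folklore] -/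
theorem disjoint_bodyFD_cuspFD (X : ℝ) : Disjoint (bodyFD X) (cuspFD X) := by
  rw [Set.disjoint_left]
  rintro g ⟨-, hb⟩ ⟨-, hc⟩
  exact absurd (show 1 ≤ C₁ * X ^ (1 / 6 : ℝ) * ((yOf g)⁻¹) ^ 2 from hb)
    (not_le.2 (show C₁ * X ^ (1 / 6 : ℝ) * ((yOf g)⁻¹) ^ 2 < 1 from hc))

/-- The cusp lies in the coordinate set of the strip above `Y₀`. [folklore] -/
theorem cuspFD_subset {X : ℝ} (hX : 0 < X) :
    cuspFD X ⊆ coordSet (stripAbove (Y0 X)) (arc 0 π) := by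
  rintro g ⟨hg, hc⟩
  obtain ⟨θ, hx, hy, hy0, -⟩ := coords_of_mem_gaussFD hg
  exact ⟨hg.1, ⟨hx, (cusp_iff_lt hX hy0).1 hc⟩, hg.2.2⟩

/-- The body lies in the coordinate set of the rectangle `√3/2 ≤ y ≤ Y₀`. [folklore] -/
theorem bodyFD_subset {X : ℝ} (hX : 0 < X) :
    bodyFD X ⊆ coordSet (rectBetween (Real.sqrt 3 / 2) (Y0 X)) (arc 0 π) := by
  rintro g ⟨hg, hb⟩
  obtain ⟨θ, hx, hy, hy0, -⟩ := coords_of_mem_gaussFD hg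
  refine ⟨hg.1, ⟨hx, hy, ?_⟩, hg.2.2⟩
  by_contra hlt; push Not at hlt
  exact absurd (show 1 ≤ C₁ * X ^ (1 / 6 : ℝ) * ((yOf g)⁻¹) ^ 2 from hb) (not_le.2 ((cusp_iff_lt hX hy0).2 hlt))

section Measure

variable [MeasurableSpace (Matrix (Fin 2) (Fin 2) ℝ)] [BorelSpace (Matrix (Fin 2) (Fin 2) ℝ)]

/-- `measurableSet_bodyFD` (auxiliary). [folklore] -/
theorem measurableSet_bodyFD (X : ℝ) : MeasurableSet (bodyFD X) :=
  measurableSet_gaussFD.inter (measurableSet_le measurable_const ((measurable_const.mul ((measurable_yOf.inv).pow_const 2))))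

/-- `measurableSet_cuspFD` (auxiliary). [folklore] -/
theorem measurableSet_cuspFD (X : ℝ) : MeasurableSet (cuspFD X) :=
  measurableSet_gaussFD.inter (measurableSet_lt ((measurable_const.mul ((measurable_yOf.inv).pow_const 2))) measurable_const)

/-- The counting function is measurable (for a section set). [folklore] -/
theorem measurable_countFn {𝓛 : Set (BinaryQuartic ℝ)} (h𝓛 : IsSectionSet 𝓛) (𝒮 : Set (BinaryQuartic ℤ)) :
    Measurable (countFn 𝓛 𝒮) := by
  unfold countFn
  exact Measurable.tsum fun x => measurable_one.indicator (measurableSet_Eset h𝓛 _)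

/-- **The measure of the cusp**: `μ(cuspFD) ≤ π / Y₀`. [cite: BhargavaShankarAnnals2015, §2.3 (cutting off the cusp; arXiv:1006.1002v2 numbering)] -/
theorem haarSL2pm_cuspFD_le {X : ℝ} (hX : 0 < X) :
    haarSL2pm (cuspFD X) ≤ ENNReal.ofReal (1 / Y0 X) * ENNReal.ofReal π := by
  have hY := Y0_pos hX
  calc haarSL2pm (cuspFD X) ≤ haarSL2pm (coordSet (stripAbove (Y0 X)) (arc 0 π)) := measure_mono (cuspFD_subset hX)
    _ = volume (((↑) : ℍ → ℂ) ⁻¹' stripAbove (Y0 X)) * volume (arc 0 π) :=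
        haarSL2pm_coordSet (measurableSet_stripAbove _) (measurableSet_arc (by linarith [Real.pi_pos]))
    _ = ENNReal.ofReal (1 / Y0 X) * ENNReal.ofReal π := by
        rw [volume_coe_preimage (measurableSet_stripAbove _) (stripAbove_subset hY.le), lintegral_stripAbove hY,
          volume_arc (by linarith [Real.pi_pos]), sub_zero]

/-- The measure of the fundamental domain is finite. [folklore] -/
theorem haarSL2pm_gaussFD_ne_top : haarSL2pm gaussFD ≠ ⊤ := by
  rw [haarSL2pm_gaussFD]; exact ENNReal.mul_ne_top ENNReal.ofReal_ne_top ENNReal.ofReal_ne_top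

/-- **Integration of `y(g)²` over the body**: `∫_{bodyFD} E y² dμ ≤ E (Y₀ − √3/2) π`. [cite: BhargavaShankarAnnals2015, §2.3 (displays (13)–(14); arXiv:1006.1002v2 numbering)] -/
theorem lintegral_bodyFD_sq_le {X : ℝ} (hX : 0 < X) {E : ℝ} (hE : 0 ≤ E) :
    ∫⁻ g in bodyFD X, ENNReal.ofReal (E * yOf g ^ 2) ∂haarSL2pm ≤
      ENNReal.ofReal E * ENNReal.ofReal (Y0 X - Real.sqrt 3 / 2) * ENNReal.ofReal π := by
  have h32 : (0 : ℝ) < Real.sqrt 3 / 2 := by positivity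
  have hF : Measurable fun w : ℂ => ENNReal.ofReal (E * w.im ^ 2) :=
    ENNReal.measurable_ofReal.comp (measurable_const.mul (Complex.measurable_im.pow_const 2))
  calc ∫⁻ g in bodyFD X, ENNReal.ofReal (E * yOf g ^ 2) ∂haarSL2pm
      ≤ ∫⁻ g in coordSet (rectBetween (Real.sqrt 3 / 2) (Y0 X)) (arc 0 π), ENNReal.ofReal (E * yOf g ^ 2) ∂haarSL2pm :=
        lintegral_mono_set (bodyFD_subset hX)
    _ = (∫⁻ w in rectBetween (Real.sqrt 3 / 2) (Y0 X), ENNReal.ofReal (E * w.im ^ 2) * ENNReal.ofReal (1 / w.im ^ 2) ∂volume) *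
          volume (arc 0 π) :=
        setLIntegral_haarSL2pm_coordSet (measurableSet_rectBetween (Real.sqrt 3 / 2) (Y0 X)) (rectBetween_subset h32)
          (Θ := arc 0 π) (measurableSet_arc (by linarith [Real.pi_pos])) _ hF
    _ = ENNReal.ofReal E * ENNReal.ofReal (Y0 X - Real.sqrt 3 / 2) * ENNReal.ofReal π := by
        have e : ∀ w : ℂ, ENNReal.ofReal (E * w.im ^ 2) * ENNReal.ofReal (1 / w.im ^ 2) =
            ENNReal.ofReal E * (ENNReal.ofReal (w.im ^ 2) * ENNReal.ofReal (1 / w.im ^ 2)) := by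
          intro w; rw [ENNReal.ofReal_mul hE, mul_assoc]
        simp_rw [e]
        have hG : Measurable (fun w : ℂ => ENNReal.ofReal (w.im ^ 2) * ENNReal.ofReal (1 / w.im ^ 2)) := by
          exact (ENNReal.measurable_ofReal.comp (Complex.measurable_im.pow_const 2)).mul
            (ENNReal.measurable_ofReal.comp (measurable_const.div (Complex.measurable_im.pow_const 2)))
        rw [lintegral_const_mul _ hG, lintegral_rectBetween h32, volume_arc (by linarith [Real.pi_pos]), sub_zero]

/-! ## The averaging integral of the irreducible count: two-sided bounds -/

/-- The averaging integral `Λ_irr(X) = ∫_𝓕 N(g) dμ(g)` of the number of irreducible forms counted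
at `g`. [cite: BhargavaShankarAnnals2015, §2.3 (eq. (8); arXiv:1006.1002v2 numbering)] -/
def LamIrr (X : ℝ) : ℝ≥0∞ := ∫⁻ g in gaussFD, countFn (sections D X) {x | x.IsIrreducible} g ∂haarSL2pm

/-- The cusp contributes nothing. [folklore] -/
theorem lintegral_cuspFD_eq_zero {X : ℝ} (hX : 0 < X) :
    ∫⁻ g in cuspFD X, countFn (sections D X) {x | x.IsIrreducible} g ∂haarSL2pm = 0 := by
  rw [setLIntegral_congr_fun (measurableSet_cuspFD X) (fun g hg => countFn_irr_eq_zero_of_cusp D hX hg.1 hg.2)]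
  exact lintegral_zero

/-- `Λ_irr` is the integral over the body. [folklore] -/
theorem LamIrr_eq_body {X : ℝ} (hX : 0 < X) :
    LamIrr D X = ∫⁻ g in bodyFD X, countFn (sections D X) {x | x.IsIrreducible} g ∂haarSL2pm := by
  rw [LamIrr, ← bodyFD_union_cuspFD X, lintegral_union (measurableSet_cuspFD X) (disjoint_bodyFD_cuspFD X),
    lintegral_cuspFD_eq_zero D hX, add_zero]

omit [MeasurableSpace (Matrix (Fin 2) (Fin 2) ℝ)] [BorelSpace (Matrix (Fin 2) (Fin 2) ℝ)] in
/-- **The counting function on the body**: at `g ∈ bodyFD` the number `N(g)` of irreducible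
forms counted is finite, `N(g) ≤ M + E₁ y(g)²`, and `M − (E₁ + E₂) y(g)² − Red ≤ N(g)` for every
bound `Red` of the reducible forms with `e ≠ 0` counted at `g` (`M = X^{5/6} vol(B₁)`,
`E₁ = 576000KΛ⁴`, `E₂ = 256 (C₁X^{1/6})⁴`). [folklore] -/
theorem countFn_body {X : ℝ} (hX : 1 ≤ X) {g : Matrix (Fin 2) (Fin 2) ℝ} (hg : g ∈ bodyFD X) :
    ∃ θ : ℝ, ∃ N : ℕ, |xOf g| ≤ 1 / 2 ∧ Real.sqrt 3 / 2 ≤ yOf g ∧ 1 ≤ C₁ * X ^ (1 / 6 : ℝ) * ((yOf g)⁻¹) ^ 2 ∧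
      countFn (sections D X) {x | x.IsIrreducible} g = (N : ℝ≥0∞) ∧
      (N : ℝ) ≤ X ^ (5 / 6 : ℝ) * volume.real (B1set D) + 576000 * K * Lam D X ^ 4 * yOf g ^ 2 ∧
      ∀ Red : ℝ, (({f : BinaryQuartic ℤ | (f.map (Int.castRingHom ℝ)).coeffs ∈
          regionS (sections D X) (iwasawaGinv (xOf g) (yOf g) θ) ∧ f.e ≠ 0 ∧ ¬ f.IsIrreducible}).ncard : ℝ) ≤ Red →
        X ^ (5 / 6 : ℝ) * volume.real (B1set D) - 576000 * K * Lam D X ^ 4 * yOf g ^ 2 -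
          256 * (C₁ * X ^ (1 / 6 : ℝ)) ^ 4 * yOf g ^ 2 - Red ≤ N := by
  obtain ⟨hgF, hb⟩ := hg
  obtain ⟨θ, hx, hy, hy0, hgeq⟩ := coords_of_mem_gaussFD hgF
  have hreg : regionS (sections D X) g = regionS (sections D X) (iwasawaGinv (xOf g) (yOf g) θ) := by rw [← hgeq]
  obtain ⟨hfin, hup, hlo⟩ := body_pointwise D hX hx hy hb (θ := θ) le_rfl
  refine ⟨θ, ({f : BinaryQuartic ℤ | f.IsIrreducible ∧
      (f.map (Int.castRingHom ℝ)).coeffs ∈ regionS (sections D X) (iwasawaGinv (xOf g) (yOf g) θ)}).ncard,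
    hx, hy, hb, ?_, hup, fun Red hRed => by linarith⟩
  rw [countFn_irr_eq_encard _ hgF.1, hreg, ← hfin.cast_ncard_eq]
  simp

/-- **Upper bound**: `Λ_irr ≤ M μ(𝓕) + E₁ (Y₀ − √3/2) π` with `M = X^{5/6} vol(B₁)`,
`E₁ = 576000 K Λ⁴`; in particular `Λ_irr < ∞`. [cite: BhargavaShankarAnnals2015, §2.3 (eqs. (8)–(14); arXiv:1006.1002v2 numbering)] -/
theorem LamIrr_le {X : ℝ} (hX : 1 ≤ X) :
    LamIrr D X ≤ ENNReal.ofReal (X ^ (5 / 6 : ℝ) * volume.real (B1set D)) * haarSL2pm gaussFD +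
      ENNReal.ofReal (576000 * K * Lam D X ^ 4) * ENNReal.ofReal (Y0 X - Real.sqrt 3 / 2) * ENNReal.ofReal π := by
  have hX0 : 0 < X := by linarith
  set M := X ^ (5 / 6 : ℝ) * volume.real (B1set D) with hM
  set E₁ := 576000 * K * Lam D X ^ 4 with hE₁
  have hMnn : 0 ≤ M := mul_nonneg (Real.rpow_nonneg hX0.le _) ENNReal.toReal_nonneg
  have hE₁nn : 0 ≤ E₁ := by have := Lam_pos D hX0; positivity
  rw [LamIrr_eq_body D hX0]
  have hpt : ∀ g ∈ bodyFD X, countFn (sections D X) {x | x.IsIrreducible} g ≤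
      ENNReal.ofReal M + ENNReal.ofReal (E₁ * yOf g ^ 2) := by
    intro g hg
    obtain ⟨θ, N, -, -, -, hN, hup, -⟩ := countFn_body D hX hg
    rw [hN, show ((N : ℕ) : ℝ≥0∞) = ENNReal.ofReal (N : ℝ) by rw [ENNReal.ofReal_natCast],
      ← ENNReal.ofReal_add hMnn (by positivity)]
    exact ENNReal.ofReal_le_ofReal hup
  calc ∫⁻ g in bodyFD X, countFn (sections D X) {x | x.IsIrreducible} g ∂haarSL2pm
      ≤ ∫⁻ g in bodyFD X, (ENNReal.ofReal M + ENNReal.ofReal (E₁ * yOf g ^ 2)) ∂haarSL2pm :=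
        setLIntegral_mono' (measurableSet_bodyFD X) hpt
    _ = ENNReal.ofReal M * haarSL2pm (bodyFD X) + ∫⁻ g in bodyFD X, ENNReal.ofReal (E₁ * yOf g ^ 2) ∂haarSL2pm := by
        rw [lintegral_add_left measurable_const, lintegral_const, Measure.restrict_apply MeasurableSet.univ, Set.univ_inter]
    _ ≤ ENNReal.ofReal M * haarSL2pm gaussFD + ENNReal.ofReal E₁ * ENNReal.ofReal (Y0 X - Real.sqrt 3 / 2) * ENNReal.ofReal π := by
        gcongr
        · exact Set.inter_subset_left
        · exact lintegral_bodyFD_sq_le hX0 hE₁nn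

/-- `Λ_irr` is finite. [folklore] -/
theorem LamIrr_ne_top {X : ℝ} (hX : 1 ≤ X) : LamIrr D X ≠ ⊤ := by
  refine ne_top_of_le_ne_top ?_ (LamIrr_le D hX)
  refine ENNReal.add_ne_top.2 ⟨ENNReal.mul_ne_top ENNReal.ofReal_ne_top haarSL2pm_gaussFD_ne_top, ?_⟩
  exact ENNReal.mul_ne_top (ENNReal.mul_ne_top ENNReal.ofReal_ne_top ENNReal.ofReal_ne_top) ENNReal.ofReal_ne_top

/-- **Lower bound** (additive form): `M μ(𝓕) ≤ Λ_irr + (E₁ + E₂)(Y₀ − √3/2)π + Red μ(𝓕) + M π/Y₀`,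
for any uniform bound `Red` of the reducible forms with `e ≠ 0` counted in the body (Lemma 2.3)
and provided `𝓛_X` is a section set. [cite: BhargavaShankarAnnals2015, §2.3 (eqs. (8)–(15) with Lemma 2.3; arXiv:1006.1002v2 numbering)] -/
theorem LamIrr_ge {X : ℝ} (hX : 1 ≤ X) (h𝓛 : IsSectionSet (sections D X)) {RedB : ℝ} (hRedB : 0 ≤ RedB)
    (hRed : ∀ x y θ : ℝ, |x| ≤ 1 / 2 → Real.sqrt 3 / 2 ≤ y → 1 ≤ C₁ * X ^ (1 / 6 : ℝ) * (y⁻¹) ^ 2 →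
      (({f : BinaryQuartic ℤ | (f.map (Int.castRingHom ℝ)).coeffs ∈ regionS (sections D X) (iwasawaGinv x y θ) ∧
        f.e ≠ 0 ∧ ¬ f.IsIrreducible}).ncard : ℝ) ≤ RedB) :
    ENNReal.ofReal (X ^ (5 / 6 : ℝ) * volume.real (B1set D)) * haarSL2pm gaussFD ≤
      LamIrr D X + ENNReal.ofReal (576000 * K * Lam D X ^ 4 + 256 * (C₁ * X ^ (1 / 6 : ℝ)) ^ 4) *
          ENNReal.ofReal (Y0 X - Real.sqrt 3 / 2) * ENNReal.ofReal π +
        ENNReal.ofReal RedB * haarSL2pm gaussFD +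
        ENNReal.ofReal (X ^ (5 / 6 : ℝ) * volume.real (B1set D)) * (ENNReal.ofReal (1 / Y0 X) * ENNReal.ofReal π) := by
  have hX0 : 0 < X := by linarith
  set M := X ^ (5 / 6 : ℝ) * volume.real (B1set D) with hM
  set E := 576000 * K * Lam D X ^ 4 + 256 * (C₁ * X ^ (1 / 6 : ℝ)) ^ 4 with hE
  have hMnn : 0 ≤ M := mul_nonneg (Real.rpow_nonneg hX0.le _) ENNReal.toReal_nonneg
  have hEnn : 0 ≤ E := by have := Lam_pos D hX0; have := C₁_pos; positivity
  have hmeas := measurable_countFn h𝓛 {x : BinaryQuartic ℤ | x.IsIrreducible}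
  -- pointwise on the body: `ofReal M ≤ N(g) + ofReal (E y² + RedB)`
  have hpt : ∀ g ∈ bodyFD X, (fun _ => ENNReal.ofReal M) g ≤
      countFn (sections D X) {x | x.IsIrreducible} g + ENNReal.ofReal (E * yOf g ^ 2 + RedB) := by
    intro g hg
    obtain ⟨θ, N, hx, hy, hb, hN, -, hlo⟩ := countFn_body D hX hg
    have hlo' := hlo RedB (hRed _ _ θ hx hy hb)
    rw [hN, show ((N : ℕ) : ℝ≥0∞) = ENNReal.ofReal (N : ℝ) by rw [ENNReal.ofReal_natCast],
      ← ENNReal.ofReal_add (Nat.cast_nonneg N) (by positivity)]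
    exact ENNReal.ofReal_le_ofReal (by nlinarith)
  -- integrate over the body
  have hbody : ENNReal.ofReal M * haarSL2pm (bodyFD X) ≤
      LamIrr D X + ENNReal.ofReal E * ENNReal.ofReal (Y0 X - Real.sqrt 3 / 2) * ENNReal.ofReal π +
        ENNReal.ofReal RedB * haarSL2pm (bodyFD X) := by
    have hErr : Measurable fun g : Matrix (Fin 2) (Fin 2) ℝ => ENNReal.ofReal (E * yOf g ^ 2 + RedB) :=
      ENNReal.measurable_ofReal.comp ((measurable_const.mul (measurable_yOf.pow_const 2)).add measurable_const)
    calc ENNReal.ofReal M * haarSL2pm (bodyFD X) = ∫⁻ _g in bodyFD X, ENNReal.ofReal M ∂haarSL2pm := by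
          rw [lintegral_const, Measure.restrict_apply MeasurableSet.univ, Set.univ_inter]
      _ ≤ ∫⁻ g in bodyFD X, (countFn (sections D X) {x | x.IsIrreducible} g + ENNReal.ofReal (E * yOf g ^ 2 + RedB)) ∂haarSL2pm :=
          setLIntegral_mono' (measurableSet_bodyFD X) hpt
      _ = LamIrr D X + ∫⁻ g in bodyFD X, ENNReal.ofReal (E * yOf g ^ 2 + RedB) ∂haarSL2pm := by
          rw [lintegral_add_left hmeas, ← LamIrr_eq_body D hX0]
      _ = LamIrr D X + (∫⁻ g in bodyFD X, ENNReal.ofReal (E * yOf g ^ 2) ∂haarSL2pm + ENNReal.ofReal RedB * haarSL2pm (bodyFD X)) := by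
          congr 1
          have e : ∀ g : Matrix (Fin 2) (Fin 2) ℝ, ENNReal.ofReal (E * yOf g ^ 2 + RedB) =
              ENNReal.ofReal (E * yOf g ^ 2) + ENNReal.ofReal RedB := fun g => ENNReal.ofReal_add (by positivity) hRedB
          simp_rw [e]
          rw [lintegral_add_right _ measurable_const, lintegral_const, Measure.restrict_apply MeasurableSet.univ, Set.univ_inter]
      _ ≤ LamIrr D X + (ENNReal.ofReal E * ENNReal.ofReal (Y0 X - Real.sqrt 3 / 2) * ENNReal.ofReal π +
            ENNReal.ofReal RedB * haarSL2pm (bodyFD X)) := by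
          gcongr
          exact lintegral_bodyFD_sq_le hX0 hEnn
      _ = _ := by rw [add_assoc]
  -- add the cusp
  have hsplit : haarSL2pm gaussFD ≤ haarSL2pm (bodyFD X) + haarSL2pm (cuspFD X) := by
    rw [← bodyFD_union_cuspFD X]; exact measure_union_le _ _
  calc ENNReal.ofReal M * haarSL2pm gaussFD
      ≤ ENNReal.ofReal M * haarSL2pm (bodyFD X) + ENNReal.ofReal M * haarSL2pm (cuspFD X) := by
        rw [← mul_add]; gcongr
    _ ≤ (LamIrr D X + ENNReal.ofReal E * ENNReal.ofReal (Y0 X - Real.sqrt 3 / 2) * ENNReal.ofReal π +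
          ENNReal.ofReal RedB * haarSL2pm (bodyFD X)) + ENNReal.ofReal M * (ENNReal.ofReal (1 / Y0 X) * ENNReal.ofReal π) := by
        gcongr
        exact haarSL2pm_cuspFD_le hX0
    _ ≤ LamIrr D X + ENNReal.ofReal E * ENNReal.ofReal (Y0 X - Real.sqrt 3 / 2) * ENNReal.ofReal π +
          ENNReal.ofReal RedB * haarSL2pm gaussFD + ENNReal.ofReal M * (ENNReal.ofReal (1 / Y0 X) * ENNReal.ofReal π) := by
        gcongr
        exact Set.inter_subset_left

omit [MeasurableSpace (Matrix (Fin 2) (Fin 2) ℝ)] [BorelSpace (Matrix (Fin 2) (Fin 2) ℝ)] in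
/-- `C₁ ≥ 1` (test `C₁_spec` on `γ = 1` and the form `x⁴`). [folklore] -/
theorem one_le_C₁ : 1 ≤ C₁ := by
  have h := C₁_spec 1 (ofCoeffs (Pi.single 0 1)) (fun i j => by
    rw [Matrix.one_apply]; split_ifs <;> norm_num) (fun l => by
    rw [coeffs_ofCoeffs, Pi.single_apply]; split_ifs <;> simp) 0
  rw [subst_one, coeffs_ofCoeffs] at h
  simpa using h

omit [MeasurableSpace (Matrix (Fin 2) (Fin 2) ℝ)] [BorelSpace (Matrix (Fin 2) (Fin 2) ℝ)] in
/-- `Y₀ ≥ 1 > √3/2` for `X ≥ 1`. [folklore] -/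
theorem sqrt_three_div_two_le_Y0 {X : ℝ} (hX : 1 ≤ X) : Real.sqrt 3 / 2 ≤ Y0 X := by
  have h1 : 1 ≤ C₁ * X ^ (1 / 6 : ℝ) := by
    have := one_le_C₁
    have hX6 : 1 ≤ X ^ (1 / 6 : ℝ) := Real.one_le_rpow hX (by norm_num)
    nlinarith
  have hY1 : 1 ≤ Y0 X := Real.one_le_sqrt.2 h1
  have hs : Real.sqrt 3 / 2 ≤ 1 := by
    rw [div_le_one (by norm_num), show (2:ℝ) = Real.sqrt 4 by
      rw [show (4:ℝ) = 2 ^ 2 by norm_num, Real.sqrt_sq (by norm_num)]]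
    exact Real.sqrt_le_sqrt (by norm_num)
  linarith

/-- **Real-number form of the two bounds**: with `μ = μ(𝓕) = π²/3`, `M = X^{5/6} vol(B₁)`,
`E₁ = 576000KΛ⁴`, `E₂ = 256(C₁X^{1/6})⁴`:
`Λ_irr ≤ M μ + E₁ (Y₀ − √3/2) π` and `M μ ≤ Λ_irr + (E₁+E₂)(Y₀ − √3/2)π + Red μ + M π / Y₀`.
[cite: BhargavaShankarAnnals2015, §2.3 (eqs. (8)–(15); arXiv:1006.1002v2 numbering)] -/
theorem LamIrr_toReal_bounds {X : ℝ} (hX : 1 ≤ X) (h𝓛 : IsSectionSet (sections D X)) {RedB : ℝ} (hRedB : 0 ≤ RedB)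
    (hRed : ∀ x y θ : ℝ, |x| ≤ 1 / 2 → Real.sqrt 3 / 2 ≤ y → 1 ≤ C₁ * X ^ (1 / 6 : ℝ) * (y⁻¹) ^ 2 →
      (({f : BinaryQuartic ℤ | (f.map (Int.castRingHom ℝ)).coeffs ∈ regionS (sections D X) (iwasawaGinv x y θ) ∧
        f.e ≠ 0 ∧ ¬ f.IsIrreducible}).ncard : ℝ) ≤ RedB) :
    (LamIrr D X).toReal ≤ X ^ (5 / 6 : ℝ) * volume.real (B1set D) * (haarSL2pm gaussFD).toReal +
        576000 * K * Lam D X ^ 4 * (Y0 X - Real.sqrt 3 / 2) * π ∧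
    X ^ (5 / 6 : ℝ) * volume.real (B1set D) * (haarSL2pm gaussFD).toReal ≤
      (LamIrr D X).toReal + (576000 * K * Lam D X ^ 4 + 256 * (C₁ * X ^ (1 / 6 : ℝ)) ^ 4) * (Y0 X - Real.sqrt 3 / 2) * π +
        RedB * (haarSL2pm gaussFD).toReal + X ^ (5 / 6 : ℝ) * volume.real (B1set D) * (π / Y0 X) := by
  have hX0 : 0 < X := by linarith
  have hY := Y0_pos hX0
  set M := X ^ (5 / 6 : ℝ) * volume.real (B1set D) with hM
  set E₁ := 576000 * K * Lam D X ^ 4 with hE₁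
  set E := 576000 * K * Lam D X ^ 4 + 256 * (C₁ * X ^ (1 / 6 : ℝ)) ^ 4 with hE
  have hMnn : 0 ≤ M := mul_nonneg (Real.rpow_nonneg hX0.le _) ENNReal.toReal_nonneg
  have hE₁nn : 0 ≤ E₁ := by have := Lam_pos D hX0; positivity
  have hEnn : 0 ≤ E := by have := Lam_pos D hX0; have := C₁_pos; positivity
  have hY32 : 0 ≤ Y0 X - Real.sqrt 3 / 2 := by linarith [sqrt_three_div_two_le_Y0 hX]
  have hμ := haarSL2pm_gaussFD_ne_top
  have hfin := LamIrr_ne_top D hX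
  constructor
  · have h := LamIrr_le D hX
    have h' := ENNReal.toReal_mono ?_ h
    · rw [ENNReal.toReal_add (ENNReal.mul_ne_top ENNReal.ofReal_ne_top hμ)
        (ENNReal.mul_ne_top (ENNReal.mul_ne_top ENNReal.ofReal_ne_top ENNReal.ofReal_ne_top) ENNReal.ofReal_ne_top),
        ENNReal.toReal_mul, ENNReal.toReal_mul, ENNReal.toReal_mul, ENNReal.toReal_ofReal hMnn, ENNReal.toReal_ofReal hE₁nn,
        ENNReal.toReal_ofReal hY32, ENNReal.toReal_ofReal Real.pi_pos.le] at h'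
      linarith
    · exact ENNReal.add_ne_top.2 ⟨ENNReal.mul_ne_top ENNReal.ofReal_ne_top hμ,
        ENNReal.mul_ne_top (ENNReal.mul_ne_top ENNReal.ofReal_ne_top ENNReal.ofReal_ne_top) ENNReal.ofReal_ne_top⟩
  · have h := LamIrr_ge D hX h𝓛 hRedB hRed
    have hne : LamIrr D X + ENNReal.ofReal E * ENNReal.ofReal (Y0 X - Real.sqrt 3 / 2) * ENNReal.ofReal π +
        ENNReal.ofReal RedB * haarSL2pm gaussFD + ENNReal.ofReal M * (ENNReal.ofReal (1 / Y0 X) * ENNReal.ofReal π) ≠ ⊤ := by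
      refine ENNReal.add_ne_top.2 ⟨ENNReal.add_ne_top.2 ⟨ENNReal.add_ne_top.2 ⟨hfin, ?_⟩, ENNReal.mul_ne_top ENNReal.ofReal_ne_top hμ⟩,
        ENNReal.mul_ne_top ENNReal.ofReal_ne_top (ENNReal.mul_ne_top ENNReal.ofReal_ne_top ENNReal.ofReal_ne_top)⟩
      exact ENNReal.mul_ne_top (ENNReal.mul_ne_top ENNReal.ofReal_ne_top ENNReal.ofReal_ne_top) ENNReal.ofReal_ne_top
    have h' := ENNReal.toReal_mono hne h
    rw [ENNReal.toReal_mul, ENNReal.toReal_ofReal hMnn, ENNReal.toReal_add (by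
        exact ENNReal.add_ne_top.2 ⟨ENNReal.add_ne_top.2 ⟨hfin, ENNReal.mul_ne_top (ENNReal.mul_ne_top ENNReal.ofReal_ne_top
          ENNReal.ofReal_ne_top) ENNReal.ofReal_ne_top⟩, ENNReal.mul_ne_top ENNReal.ofReal_ne_top hμ⟩)
        (ENNReal.mul_ne_top ENNReal.ofReal_ne_top (ENNReal.mul_ne_top ENNReal.ofReal_ne_top ENNReal.ofReal_ne_top)),
      ENNReal.toReal_add (ENNReal.add_ne_top.2 ⟨hfin, ENNReal.mul_ne_top (ENNReal.mul_ne_top ENNReal.ofReal_ne_top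
          ENNReal.ofReal_ne_top) ENNReal.ofReal_ne_top⟩) (ENNReal.mul_ne_top ENNReal.ofReal_ne_top hμ),
      ENNReal.toReal_add hfin (ENNReal.mul_ne_top (ENNReal.mul_ne_top ENNReal.ofReal_ne_top ENNReal.ofReal_ne_top) ENNReal.ofReal_ne_top),
      ENNReal.toReal_mul, ENNReal.toReal_mul, ENNReal.toReal_mul, ENNReal.toReal_mul, ENNReal.toReal_mul,
      ENNReal.toReal_ofReal hEnn, ENNReal.toReal_ofReal hY32, ENNReal.toReal_ofReal Real.pi_pos.le,
      ENNReal.toReal_ofReal hRedB, ENNReal.toReal_ofReal hMnn, ENNReal.toReal_ofReal (by positivity : (0:ℝ) ≤ 1 / Y0 X)] at h'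
    have e : M * (1 / Y0 X * π) = M * (π / Y0 X) := by ring
    linarith

end Measure

end BinaryQuartic

end Literature.NumberTheory.EllipticCurves

end
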